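import Summits.ABC.ABC.Theses.RibetTakahashiSplit
import Literature.NumberTheory.EllipticCurves.SzpiroOfAbcProofs
import Literature.NumberTheory.EllipticCurves.SzpiroLocalDataProofs
import Literature.NumberTheory.DiophantineGeometry.ConductorExponentLeEightProofs
import Literature.NumberTheory.DiophantineGeometry.ConductorFactorizationProofs

/-!
# Line `Sketch` for crux `RibetTakahashiSplit.ThinWeightedSzpiro` — stub `stub_weights`

Conductor bookkeeping for the transfer of the thin-class weighted Szpiro crux (item stmt-ABC-17927,
route `route-ABC-RibetTakahashiSplit`) to its elliptic-curve-free normal form over the map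
`(x, y) ↦ z = x³ − y²`: for a global minimal Weierstrass equation `W₀` over `ℤ` (elliptic over `ℚ`,
minimal at every finite place) that is semistable away from `2` (`p² ∤ N` for odd `p`), with
`z = c₄³ − c₆² = 1728 Δ` (Mathlib `WeierstrassCurve.c_relation`), `N` the conductor and
`T = ∏_{p ∥ N} ord_p(Δ_min)` the weight of the crux,

* (a) `rad5 z ∣ N` — every prime `p ≥ 5` of `z`, i.e. of `Δ`, is a bad prime and divides `N`
  (`WeierstrassCurve.dvd_conductorNorm_of_dvd_Δ`);
* (b) `N ∣ 768 · rad5 z`, `768 = 2⁸ · 3` — `f₂ ≤ 8`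
  (`WeierstrassCurve.conductorExponent_le_eight_holds`, Brumer–Kramer), `f_p ≤ 1` for odd `p` by
  the semistability hypothesis, `f_p = 0` for `p ∤ Δ`
  (`WeierstrassCurve.conductorExponent_eq_zero_of_not_dvd_Δ`), assembled with
  `WeierstrassCurve.conductorNorm_dvd_of_forall_conductorExponent_le`;
* (c) `wt5 z ≤ T` — for `p ≥ 5`, `p ∣ Δ`: `p ∥ N` and `ord_p(z) = ord_p(Δ) = ord_p(Δ_min)`
  (`WeierstrassCurve.minimalDiscriminantNorm_eq_natAbs_holds`), while the remaining factors of `T`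
  are `≥ 1` because `N` and `Δ_min` have the same prime factors
  (`WeierstrassCurve.radical_conductorNorm_eq_holds`).

Here `rad5 z = ∏_{p ≥ 5, p ∣ z} p` and `wt5 z = ∏_{p ≥ 5, p ∣ z} ord_p(z)` are written out as
products (the statement is free of the line's `Defs` vocabulary). Sources: J. H. Silverman,
*The Arithmetic of Elliptic Curves*, 2nd ed. 2009, VII.5.1, VIII.11 (PDF p. 221), C.16;
A. Brumer, K. Kramer, *The conductor of an abelian variety*, Compositio Math. 92 (1994), Thm 6.2
(`f₂ ≤ 8`).
-/

-- `Summit.<Summit>.<Problem>` is the mandated summit-side namespace (CONVENTIONS §2); for the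
-- single-conjunct summit `ABC` the two coincide, so the duplicate `ABC.ABC` is deliberate.
set_option linter.dupNamespace false

namespace Summit.ABC.ABC.Theorems.ThinWeightedSzpiro

open IsDedekindDomain WeierstrassCurve Rat.HeightOneSpectrum
open Literature.NumberTheory.EllipticCurves

/-! ## Arithmetic of `1728 = 2⁶ · 3³` -/

/-- For `d ≠ 0`, the prime factors `≥ 5` of `1728 d` are those of `d`. -/
private theorem filter_five_le_primeFactors_1728_mul {d : ℕ} (hd : d ≠ 0) :
    ((1728 * d).primeFactors.filter fun p ↦ 5 ≤ p) = d.primeFactors.filter fun p ↦ 5 ≤ p := by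
  rw [Nat.primeFactors_mul (by norm_num) hd, Finset.filter_union, SzpiroOfAbc.primeFactors_1728]
  have h : (({2, 3} : Finset ℕ).filter fun p ↦ 5 ≤ p) = ∅ := by decide
  rw [h, Finset.empty_union]

/-- For a prime `p ≥ 5` and `d ≠ 0`, `ord_p (1728 d) = ord_p (d)`. -/
private theorem factorization_1728_mul_of_five_le {p d : ℕ} (hp : p.Prime) (h5 : 5 ≤ p)
    (hd : d ≠ 0) : (1728 * d).factorization p = d.factorization p := by
  rw [Nat.factorization_mul (by norm_num) hd, Finsupp.add_apply]
  have h : ¬ p ∣ 1728 := fun hdvd ↦ by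
    have hmem : p ∈ Nat.primeFactors 1728 := Nat.mem_primeFactors.mpr ⟨hp, hdvd, by norm_num⟩
    rw [SzpiroOfAbc.primeFactors_1728, Finset.mem_insert, Finset.mem_singleton] at hmem
    omega
  rw [Nat.factorization_eq_zero_of_not_dvd h, zero_add]

/-! ## The three comparisons for a global minimal equation over `ℤ` -/

variable (W₀ : WeierstrassCurve ℤ)

/-- `|c₄³ − c₆²| = 1728 |Δ|` (`WeierstrassCurve.c_relation`). -/
private theorem natAbs_c₄_cube_sub_c₆_sq : (W₀.c₄ ^ 3 - W₀.c₆ ^ 2).natAbs = 1728 * W₀.Δ.natAbs := by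
  rw [← W₀.c_relation, Int.natAbs_mul]
  rfl

/-- (a) `rad5 (c₄³ − c₆²) ∣ N`: the primes `p ≥ 5` of `1728 Δ` divide `Δ`, hence `N`
(Silverman AEC VIII.11: the bad primes divide the conductor). -/
private theorem prod_five_le_primeFactors_dvd_conductorNorm [(W₀.baseChange ℚ).IsElliptic]
    (hmin : ∀ v : HeightOneSpectrum ℤ, (W₀.baseChange ℚ).IsMinimalAt v) :
    (∏ p ∈ (W₀.c₄ ^ 3 - W₀.c₆ ^ 2).natAbs.primeFactors with 5 ≤ p, p) ∣
        (W₀.baseChange ℚ).conductorNorm ℤ := by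
  have hΔ0 : W₀.Δ ≠ 0 := W₀.Δ_ne_zero_of_isElliptic_baseChange_int
  refine Finset.prod_primes_dvd _ (fun p hp ↦ ?_) (fun p hp ↦ ?_)
  · exact (Nat.prime_of_mem_primeFactors (Finset.mem_filter.mp hp).1).prime
  · obtain ⟨hp, h5⟩ := Finset.mem_filter.mp hp
    have hpp : p.Prime := Nat.prime_of_mem_primeFactors hp
    have hdvd : p ∣ W₀.Δ.natAbs := by
      have h := Nat.dvd_of_mem_primeFactors hp
      rw [natAbs_c₄_cube_sub_c₆_sq] at h
      exact SzpiroOfAbc.dvd_of_five_le_of_dvd_1728_mul hpp h5 (Int.natAbs_ne_zero.mpr hΔ0) h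
    exact W₀.dvd_conductorNorm_of_dvd_Δ hΔ0 hmin hpp (Int.natCast_dvd.mpr hdvd)

/-- (b) `N ∣ 2⁸ · 3 · rad5 (c₄³ − c₆²)`: `f₂ ≤ 8` (Brumer–Kramer), `f_p ≤ 1` for odd `p` with
`p² ∤ N`, `f_p = 0` for `p ∤ Δ`, and every odd bad prime divides `3 · rad5` (`p = 3` or `p ≥ 5`,
`p ∣ Δ`). -/
private theorem conductorNorm_dvd_mul_prod_five_le_primeFactors [(W₀.baseChange ℚ).IsElliptic]
    (hmin : ∀ v : HeightOneSpectrum ℤ, (W₀.baseChange ℚ).IsMinimalAt v)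
    (hss : ∀ p : ℕ, p.Prime → p ≠ 2 → ¬ p ^ 2 ∣ (W₀.baseChange ℚ).conductorNorm ℤ) :
    (W₀.baseChange ℚ).conductorNorm ℤ ∣
        768 * ∏ p ∈ (W₀.c₄ ^ 3 - W₀.c₆ ^ 2).natAbs.primeFactors with 5 ≤ p, p := by
  have hΔ0 : W₀.Δ ≠ 0 := W₀.Δ_ne_zero_of_isElliptic_baseChange_int
  have hN0 : (W₀.baseChange ℚ).conductorNorm ℤ ≠ 0 :=
    (conductorNorm_pos_holds (W₀.baseChange ℚ)).ne'
  set S : Finset ℕ := (W₀.c₄ ^ 3 - W₀.c₆ ^ 2).natAbs.primeFactors.filter fun p ↦ 5 ≤ p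
  have hR0 : ∏ p ∈ S, p ≠ 0 := Finset.prod_ne_zero_iff.mpr fun p hp ↦
    (Nat.prime_of_mem_primeFactors (Finset.mem_filter.mp hp).1).ne_zero
  have hB0 : 768 * ∏ p ∈ S, p ≠ 0 := mul_ne_zero (by norm_num) hR0
  -- `ord_p (N) ≤ 1` at the odd primes
  have hf1 : ∀ q : ℕ, q.Prime → q ≠ 2 → ((W₀.baseChange ℚ).conductorNorm ℤ).factorization q ≤ 1 :=
    fun q hq hq2 ↦ by
      by_contra h
      exact hss q hq hq2 ((hq.pow_dvd_iff_le_factorization hN0).mpr (by omega))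
  refine conductorNorm_dvd_of_forall_conductorExponent_le (W₀.baseChange ℚ) hB0 fun p ↦ ?_
  obtain ⟨q, hq⟩ := p
  have hv : natGenerator ((primesEquiv (R := ℤ)).symm ⟨q, hq⟩) = q :=
    Rat.natGenerator_primesEquiv_symm ⟨q, hq⟩
  have hfN : ((W₀.baseChange ℚ).conductorNorm ℤ).factorization q =
      (W₀.baseChange ℚ).conductorExponent ((primesEquiv (R := ℤ)).symm ⟨q, hq⟩) :=
    factorization_conductorNorm_primesEquiv_symm (W₀.baseChange ℚ) ⟨q, hq⟩
  by_cases hqΔ : (q : ℤ) ∣ W₀.Δ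
  swap
  · -- good reduction: `f_q = 0`
    rw [conductorExponent_eq_zero_of_not_dvd_Δ (hmin _) (by rwa [hv])]
    exact Nat.zero_le _
  rcases eq_or_ne q 2 with rfl | hq2
  · -- `f₂ ≤ 8 = ord₂ (768)`
    have h8 : (W₀.baseChange ℚ).conductorExponent ((primesEquiv (R := ℤ)).symm ⟨2, hq⟩) ≤ 8 :=
      conductorExponent_le_eight_holds (W₀.baseChange ℚ) _
    exact h8.trans ((Nat.prime_two.pow_dvd_iff_le_factorization hB0).mp
      (dvd_mul_of_dvd_left (by norm_num) _))
  · -- odd bad prime: `f_q = ord_q (N) ≤ 1 ≤ ord_q (768 · rad5)`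
    have hdvd : q ∣ 768 * ∏ p ∈ S, p := by
      rcases lt_or_ge q 5 with hq5 | hq5
      · have hq3 : q = 3 := by
          have h2 := hq.two_le
          interval_cases q
          · exact absurd rfl hq2
          · rfl
          · exact absurd hq (by norm_num)
        subst hq3
        exact dvd_mul_of_dvd_left (by norm_num) _
      · have hmem : q ∈ S := by
          refine Finset.mem_filter.mpr ⟨Nat.mem_primeFactors.mpr ⟨hq, ?_, ?_⟩, hq5⟩
          · rw [natAbs_c₄_cube_sub_c₆_sq]
            exact (Int.natCast_dvd.mp hqΔ).mul_left _
          · rw [natAbs_c₄_cube_sub_c₆_sq]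
            exact mul_ne_zero (by norm_num) (Int.natAbs_ne_zero.mpr hΔ0)
        exact dvd_mul_of_dvd_right (Finset.dvd_prod_of_mem (fun p : ℕ ↦ p) hmem) _
    have h1 : 1 ≤ (768 * ∏ p ∈ S, p).factorization q :=
      (hq.pow_dvd_iff_le_factorization hB0).mp (by rwa [pow_one])
    have h2 := hf1 q hq hq2
    change (W₀.baseChange ℚ).conductorExponent ((primesEquiv (R := ℤ)).symm ⟨q, hq⟩) ≤ _
    rw [← hfN]
    exact h2.trans h1

/-- (c) `wt5 (c₄³ − c₆²) ≤ T`: for `p ≥ 5` dividing `Δ`, `p ∥ N` and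
`ord_p (c₄³ − c₆²) = ord_p (Δ) = ord_p (Δ_min)` (global minimality); the other factors
`ord_p (Δ_min)`, `p ∥ N`, of `T` are `≥ 1` (`N` and `Δ_min` have the same prime factors). -/
private theorem prod_factorization_le_prod_factorization_minimalDiscriminantNorm
    [(W₀.baseChange ℚ).IsElliptic]
    (hmin : ∀ v : HeightOneSpectrum ℤ, (W₀.baseChange ℚ).IsMinimalAt v)
    (hss : ∀ p : ℕ, p.Prime → p ≠ 2 → ¬ p ^ 2 ∣ (W₀.baseChange ℚ).conductorNorm ℤ) :
    (∏ p ∈ (W₀.c₄ ^ 3 - W₀.c₆ ^ 2).natAbs.primeFactors with 5 ≤ p,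
        (W₀.c₄ ^ 3 - W₀.c₆ ^ 2).natAbs.factorization p) ≤
      ∏ p ∈ ((W₀.baseChange ℚ).conductorNorm ℤ).primeFactors with
          ¬ p ^ 2 ∣ (W₀.baseChange ℚ).conductorNorm ℤ,
        ((W₀.baseChange ℚ).minimalDiscriminantNorm ℤ).factorization p := by
  have hΔ0 : W₀.Δ ≠ 0 := W₀.Δ_ne_zero_of_isElliptic_baseChange_int
  have hd0 : W₀.Δ.natAbs ≠ 0 := Int.natAbs_ne_zero.mpr hΔ0
  have hN0 : (W₀.baseChange ℚ).conductorNorm ℤ ≠ 0 :=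
    (conductorNorm_pos_holds (W₀.baseChange ℚ)).ne'
  have hDm : (W₀.baseChange ℚ).minimalDiscriminantNorm ℤ = W₀.Δ.natAbs :=
    minimalDiscriminantNorm_eq_natAbs_holds W₀ hΔ0 hmin
  -- `N` and `|Δ| = |Δ_min|` have the same prime factors
  have hrad : UniqueFactorizationMonoid.radical ((W₀.baseChange ℚ).conductorNorm ℤ) =
      UniqueFactorizationMonoid.radical W₀.Δ.natAbs := by
    rw [← hDm]
    exact radical_conductorNorm_eq_holds (W₀.baseChange ℚ)
  have hpf : ((W₀.baseChange ℚ).conductorNorm ℤ).primeFactors = W₀.Δ.natAbs.primeFactors := by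
    rw [← Nat.primeFactors_radical, hrad, Nat.primeFactors_radical]
  -- rewrite the left-hand side over the primes `≥ 5` of `Δ`
  rw [hDm, natAbs_c₄_cube_sub_c₆_sq, filter_five_le_primeFactors_1728_mul hd0,
    Finset.prod_congr rfl fun p hp ↦ factorization_1728_mul_of_five_le
      (Nat.prime_of_mem_primeFactors (Finset.mem_filter.mp hp).1) (Finset.mem_filter.mp hp).2 hd0]
  refine Finset.prod_le_prod_of_subset_of_one_le' (fun p hp ↦ ?_) fun p hp _ ↦ ?_
  · -- `p ≥ 5`, `p ∣ Δ` ⟹ `p ∥ N`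
    obtain ⟨hp, h5⟩ := Finset.mem_filter.mp hp
    obtain ⟨hpp, hpd, -⟩ := Nat.mem_primeFactors.mp hp
    exact Finset.mem_filter.mpr ⟨Nat.mem_primeFactors.mpr
      ⟨hpp, W₀.dvd_conductorNorm_of_dvd_Δ hΔ0 hmin hpp (Int.natCast_dvd.mpr hpd), hN0⟩,
      hss p hpp (by omega)⟩
  · -- every prime of `N` divides `Δ`
    obtain ⟨hp, -⟩ := Finset.mem_filter.mp hp
    rw [hpf] at hp
    obtain ⟨hpp, hpd, hne⟩ := Nat.mem_primeFactors.mp hp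
    exact hpp.factorization_pos_of_dvd hne hpd

/-- **Stub `stub_weights`** of the line `Sketch` (crux `RibetTakahashiSplit.ThinWeightedSzpiro`):
for a global minimal Weierstrass equation `W₀` over `ℤ`, elliptic over `ℚ` and semistable away from
`2`, with `z = c₄³ − c₆² = 1728 Δ`, conductor `N` and weight `T = ∏_{p ∥ N} ord_p(Δ_min)`:
`rad5 z ∣ N`, `N ∣ 768 · rad5 z` (`768 = 2⁸ · 3`: `f₂ ≤ 8`, `f₃ ≤ 1`, `f_p ≤ 1`), and `wt5 z ≤ T`,
where `rad5 z = ∏_{p ≥ 5, p ∣ z} p`, `wt5 z = ∏_{p ≥ 5, p ∣ z} ord_p(z)`. -/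
theorem stub_weights : ∀ W₀ : WeierstrassCurve ℤ, (W₀.baseChange ℚ).IsElliptic →
    (∀ v : IsDedekindDomain.HeightOneSpectrum ℤ, (W₀.baseChange ℚ).IsMinimalAt v) →
    (∀ p : ℕ, p.Prime → p ≠ 2 → ¬ p ^ 2 ∣ (W₀.baseChange ℚ).conductorNorm ℤ) →
    (∏ p ∈ (W₀.c₄ ^ 3 - W₀.c₆ ^ 2).natAbs.primeFactors with 5 ≤ p, p) ∣
        (W₀.baseChange ℚ).conductorNorm ℤ ∧
    (W₀.baseChange ℚ).conductorNorm ℤ ∣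
        768 * ∏ p ∈ (W₀.c₄ ^ 3 - W₀.c₆ ^ 2).natAbs.primeFactors with 5 ≤ p, p ∧
    (∏ p ∈ (W₀.c₄ ^ 3 - W₀.c₆ ^ 2).natAbs.primeFactors with 5 ≤ p,
        (W₀.c₄ ^ 3 - W₀.c₆ ^ 2).natAbs.factorization p) ≤
      ∏ p ∈ ((W₀.baseChange ℚ).conductorNorm ℤ).primeFactors with
          ¬ p ^ 2 ∣ (W₀.baseChange ℚ).conductorNorm ℤ,
        ((W₀.baseChange ℚ).minimalDiscriminantNorm ℤ).factorization p := by
  intro W₀ hE hmin hss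
  exact ⟨prod_five_le_primeFactors_dvd_conductorNorm W₀ hmin,
    conductorNorm_dvd_mul_prod_five_le_primeFactors W₀ hmin hss,
    prod_factorization_le_prod_factorization_minimalDiscriminantNorm W₀ hmin hss⟩

end Summit.ABC.ABC.Theorems.ThinWeightedSzpiro
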